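import Mathlib.Analysis.Calculus.ContDiff.Defs
import Literature.NumberTheory.LFunctions.ZeroStatistics
import HarnessLib
import HarnessLib.Audit

/-!
# Rudnick–Sarnak `n`-level correlations: the architecture of the proof of Theorem 1.2 for `ζ`

Trunk T-ANT (`Literature/NumberTheory/LFunctions`), family `rh`, item rh.S32. Decomposition file
(D-0014 named facts) for the discharge of `Literature.NumberTheory.LFunctions.rudnick_sarnak`
(`RHConditionalFacts.lean`): the Rudnick–Sarnak theorem on the `n`-level correlations of the
zeros of `ζ` for test functions whose Fourier transform is supported in `∑ |ξ_j| < 2`.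

## Source and what it prints

Z. Rudnick, P. Sarnak, *Zeros of principal `L`-functions and random matrix theory*, Duke Math.
J. **81** (1996), 269–322 (read from the authors' copy; theorem numbers below are the paper's).

* Theorem 1.1 (p. 272) is the *smoothed* statement
  `R_n(T, f, h) ∼ (m/2π) T log T ∫ h(r)ⁿ dr ∫ f(x) W_n(x) δ(x̄) dx`, proved **without** RH.
* Theorem 1.2 (p. 273): "With the assumptions of Theorem 1.1 and also RH for `L(s, π)`,
  `R_n(B_N, f) → ∫_{ℝⁿ} f(x) W_n(x) δ((x_1 + ⋯ + x_n)/n) dx_1 ⋯ dx_n` as `N → ∞`." Here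
  `B_N = {γ̃_1, …, γ̃_N}` are the first `N` normalised ordinates `γ̃ = γ log γ / 2π`
  (`0 ≤ γ_1 ≤ γ_2 ≤ ⋯`, p. 269–270) and `R_n(B_N, f) = (n!/N) ∑_{S ⊆ B_N, |S| = n} f(S)` (1.3).
  For `m = 1` (`L = ζ`) this is exactly `Literature.NumberTheory.LFunctions.rudnick_sarnak` (whose docstring's locator
  "Theorem 1.1" should read "Theorem 1.2"; the `Prop` itself is faithful).
* The printed proof of Theorem 1.2 (for `m = 1`): the explicit formula (Prop. 2.1; in the tree
  `Literature.NumberTheory.LFunctions.explicit_formula_holds`) and `N(T) ∼ (T/2π) log T` ((2.11); `Literature.NumberTheory.LFunctions.riemann_von_mangoldt_holds`)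
  give Theorem 3.1 (smoothed *unrestricted* sums, Lemmas 3.1–3.10, pp. 284–301); under RH a
  monotone-approximation/majorant argument and a change of normalisation give **Theorem 3.2**
  (p. 285; pp. 302–304): the unrestricted sums `C_n(f, T) = ∑_{i_1, …, i_n ≤ N(T)} f(γ̃_{i_1}, …,
  γ̃_{i_n})` ((3.2), *all* index tuples) satisfy `C_n(f, T) ∼ N(T) ∫ Φ(u) C_O(u) du` ((4.1)) for
  `f = f_Φ` ((3.6)) with `Φ` supported in `∑ |ξ_j| < 2`, where `∫ Φ C_O` is the explicit
  "diagonal pairing" functional (3.9). **Section 4** then recovers the sums over *distinct*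
  indices by Möbius inversion over the lattice of set partitions ((4.5)–(4.9)), computes the
  limit of each `C_F` from Theorem 3.2 (Lemma 4.1, (4.13)–(4.16)), and identifies the result with
  the GUE determinant by the combinatorial identity **Theorem 4.1** (`Ŵ_n = R_O` on
  `∑ |u_j| < 2`, Props. 4.1–4.3, pp. 307–316): "In view of (4.15), (4.16), and the definition of
  the GUE determinant `W_n(u)` (1.5), Theorem 1.2 follows from Theorem 4.1" (p. 307).

## Contents (the DAG; `def` = named fact, not asserted)

* `Literature.rsPhiTest Φ = f_Φ`, the test function (3.6) attached to `Φ : ℝⁿ → ℂ`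
  (written on the slice `ξ_0 = -∑_{i ≥ 1} ξ_i` of the hyperplane `∑ ξ_j = 0`, unit Jacobian).
* `Literature.IsRSAdmissiblePhi k Φ`: `Φ` smooth with support inside the open region `∑ |ξ_j| < 2`
  (RS ask `Φ ∈ C²`; we only ever feed smooth `Φ`, so the facts below are specialisations).
* `Literature.unrestrictedLevelSum n f N = ∑_{i : Fin n → Fin N} f(γ̃_{i_1}, …, γ̃_{i_n})`, RS's `C_n`.
* `Literature.NumberTheory.LFunctions.IsPartialMatching`, `Literature.rsPairingFunctional n Φ = ∫ Φ C_O` (3.9).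
* `Literature.NumberTheory.LFunctions.RSUnrestrictedLimits` (conclusion of Thm 3.2 for `ζ`, all levels, with the RH
  hypothesis of Thm 3.2 removed — an OPEN statement, see "Status" below) and the named fact
  `Literature.rudnick_sarnak_unrestricted : RH → RSUnrestrictedLimits` [RS Thm 3.2, `m = 1`].
* `Literature.NumberTheory.LFunctions.RSRestrictedLimits` (conclusion of §4 for `ζ`: the `T`-indexed form of Thm 1.2 for
  `f = f_Φ`, `N = N(T)`, with the RH hypothesis of Thm 1.2 removed — an OPEN statement) and the
  named fact `Literature.rudnick_sarnak_sieving : RH → RSUnrestrictedLimits → RSRestrictedLimits`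
  [RS §4: Lemma 4.1, (4.9), (4.15)–(4.16), Theorem 4.1]; and the proved reduction
  `rsRestrictedLimits_of_gueHypothesis : tendsto_zetaZeroCount_atTop → GUEHypothesis →
  RSRestrictedLimits` (the RH-free statement is the restricted-support, `T`-indexed case of the
  universality conjecture of RS §1, Remark 1).
* The remaining step `(RH → RSRestrictedLimits) → rudnick_sarnak` (every RS test function with
  restricted Fourier support is an `f_Φ`, by Fourier inversion on the Schwartz slice; and the
  passage from `N = N(T)` to all `N`, which the paper leaves implicit — (4.5): "`B_N = B_{N(T)}`")
  is a theorem, proved in `RudnickSarnakProofs.lean`, not a fact.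

## Status of the two conclusion predicates (D-0014; verdict clean-up 2026-08-15)

`RSUnrestrictedLimits` and `RSRestrictedLimits` are CLOSED `Prop`s but they are **not** published
theorems and are never asserted: they are the conclusions of Theorem 3.2 (p. 285: "Assume the
Riemann hypothesis for `L(s, π)`; then …") and of Theorem 1.2 (p. 273: "With the assumptions of
Theorem 1.1 and also RH for `L(s, π)` …") with the RH hypothesis deleted. Rudnick–Sarnak prove
them only under RH (RH-free they have the *smoothed* Theorem 1.1, p. 272, whose sums run over
complex "ordinates" and which the tree's real-ordinate bookkeeping does not express); without RH
both are OPEN — already at level `n = 2`, where (p. 273, Remark 1: "In the case of `ζ(s)` and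
`n = 2`, Theorem 1.2 coincides with the result of Montgomery") they are Montgomery's 1973
pair-correlation theorem with its RH hypothesis deleted (the unconditional form of Montgomery's
theorem that is published — Baluyot–Goldston–Suriajaya–Turnage-Butterbaugh 2024, Theorem 1 —
weights each pair of zeros by `T^{α(ρ-ρ')} w(ρ-ρ')` with the real parts `β, β'` retained, and
"neither requires nor provides any information" on the ordinate-only sums recorded here, to
which it reduces under RH). They are registered here as open
statements (docstrings `OPEN CONJECTURE — … [status: open]`), special cases of the universality
conjecture RS §1 Remark 1 (p. 273: "In all cases we conjecture the complete universality of the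
`n`-level correlations"), which the tree records RH-free as `GUEHypothesis`
(`ZeroStatistics.lean`); `rsRestrictedLimits_of_gueHypothesis` proves the reduction for the
restricted statement. The published, RH-conditional results are the named facts
`rudnick_sarnak_unrestricted` (Thm 3.2; levels `n = 1, 2` proved in
`RudnickSarnakUnrestrictedProofs.lean` / `RudnickSarnakPairLevel.lean`) and
`rudnick_sarnak_sieving` (§4; discharged: `rudnick_sarnak_sieving_holds`,
`RudnickSarnakSievingHolds.lean`). The names are kept (both `Prop`s have users in
`RudnickSarnakProofs.lean`, `RudnickSarnakThm41.lean`, `RudnickSarnakSievingHolds.lean`, …).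

## Design choices

* Everything is for `ζ` (`m = 1`) under RH, with the tree's real-ordinate bookkeeping
  (`zetaOrdinate`, `normalizedOrdinate`, `zetaZeroCount = N(T)` counting `0 < γ ≤ T`): RS's
  (3.1)/(3.2) index the first `N(T)` ordinates, which is `Fin (zetaZeroCount T)` here (0-indexed).
  RS count zeros two-sidedly for general `π` ((2.10)); for `ζ` the zeros are symmetric and their
  proof of Thm 3.2 (p. 303: "`h_j = 𝟙_{[a,b]}`") gives the one-sided statement recorded here.
* (3.6) `f_Φ(x) = ∫_{ℝⁿ} Φ(ξ) δ(ξ_1 + ⋯ + ξ_n) e(-x·ξ) dξ` is written, for `n = k + 1`, as the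
  integral over `η = (ξ_1, …, ξ_k) ∈ ℝᵏ` with `ξ_0 = -∑ η_i` (so `x·ξ = ∑_i (x_i - x_0) η_i`); the
  substitution `(u_0, η) = (∑_j ξ_j, ξ_1, …, ξ_k)` has Jacobian `1`, so this is literally RS's
  measure `δ(∑ ξ_j) dξ`.
* (3.9): "`r` disjoint pairs `i(t) < j(t)`" are finite sets `M` of ordered pairs `(i, j)`, `i < j`,
  using pairwise disjoint index sets; `r = 0` (`M = ∅`) is the term `Φ(0)` (an integral over the
  one-point space `(∅ → ℝ)`).
* Thm 3.2 prints "`C_n(f, T) ∼ N(T) ∫ Φ C_O + O(T)`"; (4.1) restates it as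
  `C_n(f, T) ∼ N(T) ∫ Φ C_O`, and the proof (p. 303, `lim sup |D(H, f; T)| ≤ ε(…)`) gives exactly
  the asymptotic, which is what `RSUnrestrictedLimits` records (`C_n / N(T) →` limit).
* The facts are stated for all levels `n = k + 1 ≥ 1` (§4 applies Thm 3.2 at every level
  `ν(F) ∈ [1, n]`, (4.5)/(Lemma 4.1)); the sieving conclusion is for `n ≥ 2` (`1 ≤ k`) and for
  `f_Φ` satisfying TF 1–3 (`IsRSTestFunction`), as in Theorems 1.1/1.2.

## References

* Z. Rudnick, P. Sarnak, *Zeros of principal `L`-functions and random matrix theory*, Duke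
  Math. J. 81 (1996), 269–322: Thm 1.2, (3.1)–(3.10), Thms 3.1–3.2, §4 (4.1)–(4.16), Thm 4.1.
* N. M. Katz, P. Sarnak, *Zeroes of zeta functions and symmetry*, Bull. AMS 36 (1999), §1.
* S. A. C. Baluyot, D. A. Goldston, A. I. Suriajaya, C. L. Turnage-Butterbaugh, *An unconditional
  Montgomery theorem for pair correlation of zeros of the Riemann zeta-function*, Acta Arith.
  (2024), doi:10.4064/aa230612-20-3 (arXiv:2306.04799): Theorem 1 and the Remark after Theorem 2
  (status of the RH-free pair correlation; cited for the "Status" paragraph only).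
-/

noncomputable section

open Complex Filter MeasureTheory
open scoped Real Topology ContDiff

namespace Literature.NumberTheory.LFunctions

/-! ## (3.6): the test function attached to `Φ` -/

/-- RS (3.6): the test function `f_Φ(x) = ∫_{ℝⁿ} Φ(ξ) δ(ξ_1 + ⋯ + ξ_n) e(-x·ξ) dξ` attached to a
compactly supported `Φ` on `ℝⁿ`, `n = k + 1`, written as an honest integral over the hyperplane
`∑ ξ_j = 0` parametrised by `η = (ξ_1, …, ξ_k)`, `ξ_0 = -∑ η_i` (unit Jacobian against
`δ(∑ ξ_j) dξ`), where `x·ξ = ∑_i (x_i - x_0) η_i`. It is invariant under diagonal translation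
(TF 2, `rsPhiTest_add_const`). (Rudnick–Sarnak 1996, (3.6).) [cite: RudnickSarnak1996, (3.6)] -/
def rsPhiTest {k : ℕ} (Φ : (Fin (k + 1) → ℝ) → ℂ) (x : Fin (k + 1) → ℝ) : ℂ :=
  ∫ η : Fin k → ℝ, Φ (Fin.cons (-∑ i, η i) η) *
    Complex.exp (-(2 * π * I * ∑ i, ((x i.succ - x 0) * η i : ℝ)))

/-- TF 2 for `f_Φ`: `f_Φ(x + t(1, …, 1)) = f_Φ(x)` (the phase only involves the differences
`x_i - x_0`). (Rudnick–Sarnak 1996, remark after (3.5): "we get an `f` satisfying TF 2".)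
[cite: RudnickSarnak1996, (3.6)] -/
theorem rsPhiTest_add_const {k : ℕ} (Φ : (Fin (k + 1) → ℝ) → ℂ) (x : Fin (k + 1) → ℝ) (t : ℝ) :
    rsPhiTest Φ (fun i ↦ x i + t) = rsPhiTest Φ x := by
  simp [rsPhiTest, add_sub_add_right_eq_sub]

/-- The slice `y ↦ f_Φ(0, y)` of `f_Φ` is `∫ Φ(-∑ η, η) e(-y·η) dη`, the (inverse-oriented)
Fourier integral of `Φ` restricted to the hyperplane. [cite: RudnickSarnak1996, (3.6)] -/
theorem rsSlice_rsPhiTest {k : ℕ} (Φ : (Fin (k + 1) → ℝ) → ℂ) (y : Fin k → ℝ) :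
    rsSlice (rsPhiTest Φ) y =
      ∫ η : Fin k → ℝ, Φ (Fin.cons (-∑ i, η i) η) *
        Complex.exp (-(2 * π * I * ∑ i, (y i * η i : ℝ))) := by
  simp [rsSlice, rsPhiTest]

/-- Admissible `Φ` at level `n = k + 1` for `ζ` (`m = 1`): `Φ` is smooth and supported inside the
open region `∑_j |ξ_j| < 2`, i.e. `Φ(ξ) = 0` whenever `∑_j |ξ_j| ≥ 2 - δ` for some `δ > 0`
(compact support in the open region; RS, Thm 3.2: "`Φ ∈ C²(ℝⁿ)` supported in `∑ |ξ_j| < 2/m`" —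
smoothness `C^∞` is asked here, which only specialises the facts below).
[cite: RudnickSarnak1996, Thm 3.2] -/
structure IsRSAdmissiblePhi (k : ℕ) (Φ : (Fin (k + 1) → ℝ) → ℂ) : Prop where
  /-- `Φ` is smooth. -/
  contDiff : ContDiff ℝ ∞ Φ
  /-- `Φ` vanishes on `∑_j |ξ_j| ≥ 2 - δ` for some `δ > 0`. -/
  support_subset : ∃ δ : ℝ, 0 < δ ∧ ∀ ξ : Fin (k + 1) → ℝ, 2 - δ ≤ ∑ j, |ξ j| → Φ ξ = 0

/-- An admissible `Φ` vanishes outside the sup-norm ball of radius `2`. [folklore] -/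
theorem IsRSAdmissiblePhi.eq_zero_of_le_norm {k : ℕ} {Φ : (Fin (k + 1) → ℝ) → ℂ}
    (h : IsRSAdmissiblePhi k Φ) {ξ : Fin (k + 1) → ℝ} (hξ : 2 ≤ ‖ξ‖) : Φ ξ = 0 := by
  obtain ⟨δ, hδ, hΦ⟩ := h.support_subset
  refine hΦ ξ ?_
  obtain ⟨j, hj⟩ : ∃ j, ‖ξ‖ ≤ |ξ j| := by
    have hne : (Finset.univ : Finset (Fin (k + 1))).Nonempty := Finset.univ_nonempty
    obtain ⟨j, -, hj⟩ := Finset.exists_max_image Finset.univ (fun j ↦ |ξ j|) hne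
    refine ⟨j, ?_⟩
    rw [pi_norm_le_iff_of_nonneg (abs_nonneg _)]
    intro i
    simpa [Real.norm_eq_abs] using hj i (Finset.mem_univ i)
  have : |ξ j| ≤ ∑ i, |ξ i| :=
    Finset.single_le_sum (f := fun i ↦ |ξ i|) (fun i _ ↦ abs_nonneg (ξ i)) (Finset.mem_univ j)
  linarith

/-- An admissible `Φ` has compact support (its support lies in the closed sup-norm ball of
radius `2`). [folklore] -/
theorem IsRSAdmissiblePhi.hasCompactSupport {k : ℕ} {Φ : (Fin (k + 1) → ℝ) → ℂ}
    (h : IsRSAdmissiblePhi k Φ) : HasCompactSupport Φ := by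
  refine HasCompactSupport.of_support_subset_isCompact (isCompact_closedBall (0 : Fin (k + 1) → ℝ) 2)
    fun ξ hξ ↦ ?_
  rw [Metric.mem_closedBall, dist_zero_right]
  by_contra hlt
  exact hξ (h.eq_zero_of_le_norm (not_le.1 hlt).le)

/-! ## (3.2)/(4.1): unrestricted correlation sums -/

/-- RS (3.2)/(4.1): the *unrestricted* `n`-level sum of the first `N` normalised ordinates,
`C_n = ∑_{i_1, …, i_n ≤ N} f(γ̃_{i_1}, …, γ̃_{i_n})`, over **all** index tuples
`i : Fin n → Fin N` (coincidences allowed; compare `levelCorrelationSum`, the same sum over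
injective `i`, which is RS's `N · R_n`). RS's `C_n(f, T)` is
`unrestrictedLevelSum n f (zetaZeroCount T)`. [cite: RudnickSarnak1996, (3.2)] -/
def unrestrictedLevelSum (n : ℕ) (f : (Fin n → ℝ) → ℂ) (N : ℕ) : ℂ :=
  ∑ i : Fin n → Fin N, f fun l ↦ normalizedOrdinate (i l)

/-! ## (3.9): the diagonal-pairing functional `∫ Φ C_O` -/

/-- A set of `r` *disjoint pairs* `i(t) < j(t)` in `{0, …, n-1}` (RS (3.9)): a finite set `M` of
ordered pairs `(i, j)` with `i < j`, whose underlying two-element index sets are pairwise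
disjoint. `M = ∅` is allowed (`r = 0`). [cite: RudnickSarnak1996, (3.9)] -/
def IsPartialMatching {n : ℕ} (M : Finset (Fin n × Fin n)) : Prop :=
  (∀ p ∈ M, p.1 < p.2) ∧ (M : Set (Fin n × Fin n)).PairwiseDisjoint fun p ↦ ({p.1, p.2} : Finset (Fin n))

/-- RS (3.10): `e_{i,j} = e_i - e_j`, `e_i` the `i`-th standard basis vector of `ℝⁿ`.
[cite: RudnickSarnak1996, (3.10)] -/
def rsBasisDiff {n : ℕ} (p : Fin n × Fin n) : Fin n → ℝ :=
  Pi.single p.1 1 - Pi.single p.2 1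

open scoped Classical in
/-- RS (3.9): the diagonal-pairing functional
`∫_{ℝⁿ} Φ(v) C_O(v) dv := Φ(0) + ∑_{r=1}^{⌊n/2⌋} ∑ ∫⋯∫ |v_1| ⋯ |v_r|
  Φ(v_1 e_{i(1),j(1)} + ⋯ + v_r e_{i(r),j(r)}) dv_1 ⋯ dv_r`,
"where the sum is over all choices of `r` disjoint pairs of indices `i(t) < j(t)` in
`{1, …, n}`" — here a single sum over partial matchings `M` (`IsPartialMatching`), the term
`M = ∅` being `Φ(0)` (integral over the one-point space `∅ → ℝ`). This is the limit of
`C_n(f_Φ, T)/N(T)` in Theorem 3.2. [cite: RudnickSarnak1996, (3.9)] -/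
def rsPairingFunctional (n : ℕ) (Φ : (Fin n → ℝ) → ℂ) : ℂ :=
  ∑ M ∈ (Finset.univ : Finset (Finset (Fin n × Fin n))).filter IsPartialMatching,
    ∫ v : M → ℝ, ((∏ p, |v p| : ℝ) : ℂ) * Φ (∑ p : M, v p • rsBasisDiff (p : Fin n × Fin n))

/-- The `r = 0` term of (3.9) (the empty matching) is `Φ(0)`: the integral over the one-point
space `∅ → ℝ` (whose `volume` is a Dirac mass) of `1 · Φ(0)`. [cite: RudnickSarnak1996, (3.9)] -/
theorem integral_emptyMatching_eq {n : ℕ} (Φ : (Fin n → ℝ) → ℂ) :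
    (∫ v : ((∅ : Finset (Fin n × Fin n)) : Type) → ℝ,
      ((∏ p, |v p| : ℝ) : ℂ) * Φ (∑ p, v p • rsBasisDiff (p : Fin n × Fin n))) = Φ 0 := by
  have : (volume : Measure (((∅ : Finset (Fin n × Fin n)) : Type) → ℝ)) =
      Measure.dirac (fun p ↦ isEmptyElim p) := by
    rw [volume_pi]
    exact Measure.pi_of_empty _ _
  rw [this, integral_dirac]
  simp

open scoped Classical in
/-- At level `n = 1` there are no pairs, and `∫ Φ C_O = Φ(0)` (consistent with
`C_1(f_Φ, T) = N(T) · f_Φ = N(T) · Φ(0)` for the constant function `f_Φ`, `n = 1`).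
[cite: RudnickSarnak1996, (3.9)] -/
theorem rsPairingFunctional_one (Φ : (Fin 1 → ℝ) → ℂ) : rsPairingFunctional 1 Φ = Φ 0 := by
  unfold rsPairingFunctional
  have hfilter :
      (Finset.univ : Finset (Finset (Fin 1 × Fin 1))).filter IsPartialMatching = {∅} := by
    ext M
    simp only [Finset.mem_filter, Finset.mem_univ, true_and, Finset.mem_singleton]
    constructor
    · intro hM
      ext p
      simp only [Finset.notMem_empty, iff_false]
      intro hp
      exact absurd (hM.1 p hp) (by simp [Subsingleton.elim p.1 p.2])
    · rintro rfl
      exact ⟨by simp, by simp [Set.PairwiseDisjoint]⟩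
  rw [hfilter, Finset.sum_singleton]
  exact integral_emptyMatching_eq Φ

/-! ## Theorem 3.2 for `ζ`: limits of the unrestricted sums -/

/-- OPEN CONJECTURE — [status: open]. The conclusion of Rudnick–Sarnak's Theorem 3.2 for `ζ`
(`m = 1`) **with its RH hypothesis removed**, at every level `n = k + 1 ≥ 1`: for every admissible
`Φ` (`IsRSAdmissiblePhi`), the unrestricted sums of `f_Φ` over the first `N(T)` normalised
ordinates satisfy `C_n(f_Φ, T) / N(T) → ∫ Φ C_O` as `T → ∞`
((4.1): "`C_n(f, T) ∼ N(T) · ∫ f̂(u) C_O(u) du`").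
*What is published.* Rudnick–Sarnak, Duke Math. J. 81 (1996), Theorem 3.2 (p. 285): "Assume the
Riemann hypothesis for `L(s, π)`; then `C_n(f, T) ∼ N(T) ∫ Φ(u) C_O(u) du`" — i.e. exactly
`RH → RSUnrestrictedLimits`, the named fact `rudnick_sarnak_unrestricted` below, of which this
`Prop` is the conclusion predicate (the hypothesis consumed by the sieving step
`rudnick_sarnak_sieving`). No RH-free proof is published: RH-free, RS have only the smoothed
Theorem 3.1/Theorem 1.1 (p. 272), over complex "ordinates".
*Where posed.* It is the unrestricted-sum companion, on the restricted-support class, of the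
universality conjecture RS §1, Remark 1 (p. 273: "In all cases we conjecture the complete
universality of the `n`-level correlations"), recorded RH-free for the ordinates as
`GUEHypothesis` (`ZeroStatistics.lean`): by (4.7) (p. 305, `C_O(f, T) = ∑_{F ∈ Π_n} R_F(f, T)`)
the unrestricted sum is a finite combination of the correlation sums of levels `≤ n`.
*In the tree.* Level `n = 1` is proved outright (`rsUnrestrictedLimits_zero`,
`RudnickSarnakUnrestrictedProofs.lean`); level `n = 2` is proved under RH from Montgomery's
theorem (`rsUnrestrictedLimits_one`, `RudnickSarnakPairLevel.lean`) — without RH it is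
Montgomery's pair-correlation theorem (1973, Theorem, `|α| < 1`) with its RH hypothesis deleted,
which is open (the published unconditional variant, Baluyot–Goldston–Suriajaya–Turnage-Butterbaugh
2024, Thm 1, keeps the real parts `β` of the zeros in the weights `T^{α(ρ-ρ')}`); and
`RH → RSUnrestrictedLimits → RSRestrictedLimits` is proved
(`rudnick_sarnak_sieving_holds`, `RudnickSarnakSievingHolds.lean`; its proof does not use RH).
Never asserted; nothing to discharge as stated. [cite: RudnickSarnak1996, Thm 3.2 (p. 285), (4.1), §1 Remark 1 (p. 273)] -/
@[conjecture] def RSUnrestrictedLimits : Prop :=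
  ∀ {k : ℕ} {Φ : (Fin (k + 1) → ℝ) → ℂ}, IsRSAdmissiblePhi k Φ →
    Tendsto (fun T : ℝ ↦ unrestrictedLevelSum (k + 1) (rsPhiTest Φ) (zetaZeroCount T) /
      zetaZeroCount T) atTop (𝓝 (rsPairingFunctional (k + 1) Φ))

/-- **rh.S32** NAMED FACT (Rudnick–Sarnak, Duke Math. J. 81 (1996), **Theorem 3.2** for
`L = ζ`, `m = 1`, p. 285: "Let `Φ ∈ C²(ℝⁿ)` be supported in `∑ |ξ_j| < 2/m`, and `f` be given by
(3.6). Assume the Riemann hypothesis for `L(s, π)`; then `C_n(f, T) ∼ N(T) ∫_{ℝⁿ} Φ(u) C_O(u) du`",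
with `C_n(f, T) = ∑_{i_1, …, i_n ≤ N(T)} f(γ̃_{i_1}, …, γ̃_{i_n})` (3.2) and `∫ Φ C_O` as in
(3.9); restated as (4.1)). Proof in print: the explicit formula (Prop. 2.1) gives the smoothed
Theorem 3.1 unconditionally (Lemmas 3.1–3.10); under RH, monotone approximation of `𝟙_{[a,b]}`
by admissible cut-offs with admissible majorants `f₊ ≥ |f|`, then the change of normalisation
`(L/2π)γ ↦ γ̃` ((3.71)–(3.77)). Recorded for smooth `Φ` (a specialisation) and one-sidedly
(zeros `0 < γ ≤ T`, as the tree counts them; RS p. 303 allow `h_j = 𝟙_{[a,b]}`).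
Users take `(h : rudnick_sarnak_unrestricted)`. [cite: RudnickSarnak1996, Thm 3.2] -/
def rudnick_sarnak_unrestricted : Prop :=
  RiemannHypothesis → RSUnrestrictedLimits

/-! ## Section 4 for `ζ`: sieving to distinct indices and Theorem 4.1 -/

/-- OPEN CONJECTURE — [status: open]. The conclusion of Rudnick–Sarnak's §4 / Theorem 1.2 for
`ζ` **with its RH hypothesis removed**: for `n = k + 1 ≥ 2` and every admissible `Φ` whose `f_Φ`
satisfies TF 1–3, the `n`-level correlation sums over *distinct* indices among the first `N(T)`
normalised ordinates satisfy `R_n(f_Φ, T) = levelCorrelationSum n f_Φ N(T) / N(T) →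
∫ f_Φ(x) W_n(x) δ(x̄) dx = rsLimit k f_Φ` as `T → ∞` — Theorem 1.2 in its `T`-indexed form
`B_N = B_{N(T)}` ((3.1), (4.5), (4.15)).
*What is published.* Rudnick–Sarnak, Duke Math. J. 81 (1996), Theorem 1.2 (p. 273): "With the
assumptions of Theorem 1.1 and also RH for `L(s, π)`, `R_n(B_N, f) → ∫ f(x) W_n(x) δ(…) dx`",
obtained in §4 from Theorem 3.2 ((4.9), (4.15)–(4.16) and Theorem 4.1, p. 307: "In view of
(4.15), (4.16), and the definition of the GUE determinant `W_n(u)` (1.5), Theorem 1.2 follows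
from Theorem 4.1"). In the tree this is `rudnick_sarnak_sieving_holds : RH →
RSUnrestrictedLimits → RSRestrictedLimits` (`RudnickSarnakSievingHolds.lean`) composed with the
named fact `rudnick_sarnak_unrestricted`; this `Prop` is the conclusion predicate. No RH-free
proof is published (RH-free, RS have only the smoothed Theorem 1.1, p. 272, over complex
"ordinates", which the real-ordinate bookkeeping here does not express).
*Where posed.* It is the special case `supp f̂ ⊂ {∑ |ξ_j| < 2}`, `N = N(T)`, of the universality
conjecture RS §1, Remark 1 (p. 273: "In all cases we conjecture the complete universality of the
`n`-level correlations — that is to say that Theorems 1.1 and 1.2 hold without any restrictions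
on the support of `f̂`"), recorded RH-free for the ordinates as `GUEHypothesis`
(`ZeroStatistics.lean`), from which it follows given `N(T) → ∞`:
`rsRestrictedLimits_of_gueHypothesis` below. At `n = 2` (p. 273: "In the case of `ζ(s)` and
`n = 2`, Theorem 1.2 coincides with the result of Montgomery") it is Montgomery's
pair-correlation theorem (1973, Theorem, `|α| < 1`) with its RH hypothesis deleted — open (the
published unconditional variant, Baluyot–Goldston–Suriajaya–Turnage-Butterbaugh 2024, Thm 1,
keeps the real parts `β` of the zeros in the weights). Never asserted; nothing to discharge as
stated. [cite: RudnickSarnak1996, Thm 1.2 (p. 273), §1 Remark 1, (4.15)–(4.16) and Thm 4.1 (p. 307)] -/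
@[conjecture] def RSRestrictedLimits : Prop :=
  ∀ {k : ℕ}, 1 ≤ k → ∀ {Φ : (Fin (k + 1) → ℝ) → ℂ}, IsRSAdmissiblePhi k Φ →
    IsRSTestFunction k (rsPhiTest Φ) →
      Tendsto (fun T : ℝ ↦ levelCorrelationSum (k + 1) (rsPhiTest Φ) (zetaZeroCount T) /
        zetaZeroCount T) atTop (𝓝 (rsLimit k (rsPhiTest Φ)))

/-- The RH-free restricted statement is a special case of the universality conjecture: the GUE
hypothesis (`GUEHypothesis`: for every level `n = k + 1 ≥ 2` and every RS test function `f`,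
`levelCorrelationSum n f N / N → rsLimit k f` as `N → ∞`; RS §1, Remark 1, p. 273) implies
`RSRestrictedLimits`, by specialising to `f = f_Φ` and composing with `N(T) → ∞`
(`tendsto_zetaZeroCount_atTop`, `ZetaZeros.lean`; discharged in `ZetaArgVariation.lean` as
`tendsto_zetaZeroCount_atTop_holds`, taken as a hypothesis here to keep this file's imports).
[cite: RudnickSarnak1996, §1 Remark 1 (p. 273) and (4.5)] -/
theorem rsRestrictedLimits_of_gueHypothesis (hN : tendsto_zetaZeroCount_atTop)
    (h : GUEHypothesis) : RSRestrictedLimits :=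
  fun {k} hk {Φ} _ hf ↦ (h k hk (rsPhiTest Φ) hf).comp hN

/-- **rh.S32** NAMED FACT (Rudnick–Sarnak, Duke Math. J. 81 (1996), **§4** for `L = ζ`:
combinatorial sieving plus Theorem 4.1). As printed: the sums over distinct indices are recovered
from the unrestricted ones by Möbius inversion over the lattice `Π_n` of set partitions,
`R_O(f, T) = ∑_F μ(O, F) C_F(f, T)` (4.9), `C_F(f, T) = C_ν(ι_F^* f, T)` (4.6) with
`ι_F^* f_Φ = f_{Φ_F}` (4.14); Theorem 3.2 at each level `ν(F)` gives Lemma 4.1 and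
`R_O(f, T) = N(T) ∫ Φ(u) R_O(u) du + o(N(T))`, `R_O(u) = ∑_F μ(O, F) C_F(u)` ((4.15)–(4.16));
and **Theorem 4.1** ("Let `W_n(x) = det(K(x_i - x_j))`, `K(x) = sin πx/πx`. Then, for
`∑_j |u_j| < 2`, the Fourier transform `Ŵ_n(u)` is equal to `R_O(u)`", proved via Props. 4.1–4.3)
turns the limit into `∫ f(x) W_n(x) δ(x̄) dx`: "In view of (4.15), (4.16), and the definition of
the GUE determinant, Theorem 1.2 follows from Theorem 4.1" (p. 307). Recorded as the implication
it is used for: under RH, the conclusion of Theorem 3.2 at all levels (`RSUnrestrictedLimits`)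
implies the `T`-indexed Theorem 1.2 for every admissible `f_Φ` (`RSRestrictedLimits`).
Users take `(h : rudnick_sarnak_sieving)`. [cite: RudnickSarnak1996, §4: Lemma 4.1, (4.9), (4.15)–(4.16), Thm 4.1] -/
def rudnick_sarnak_sieving : Prop :=
  RiemannHypothesis → RSUnrestrictedLimits → RSRestrictedLimits

end Literature.NumberTheory.LFunctions

end
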